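import Summits.BirchSwinnertonDyer.BirchSwinnertonDyer.Theorems.PrintCFramBottomClassIndexLawFiveLeBernoulliUnitsDictionary
import Summits.BirchSwinnertonDyer.BirchSwinnertonDyer.Theorems.PrintCFramBottomClassIndexLawFiveLeHerbrandQuadraticFrobenius
import Literature.NumberTheory.EllipticCurves.OpenImageMazurCharacterProofs
import Literature.NumberTheory.GaloisRepresentations.InducedGaloisRep
import Literature.NumberTheory.NumberFields.CongruenceSubgroupTorsionFree
import HarnessLib

/-!
# Route `PrintCFram`, crux C2 `BottomClassIndexLawFiveLe` (stmt-BirchSwinnertonDyer-20372), line `eisenstein-resource-bdp-line`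
# v13 (LEAD g9, Road C), stub `stub_lineDictionary`: THE KRONECKER AVATAR OF THE QUADRATIC GALOIS CHARACTER —
# `Teich(ε τ) = ε_K(χ_{|d_K|} τ)` POINTWISE ON `Γ_ℚ` (the binder `hεav` of `BernoulliUnits.lineDictionary_dirichlet`)
# (cell `bsd-print-cfram`, width seat `bsd-line-cfram-p1-w4` g6; helper `--supports` 20372; THEOREMS ONLY, 0 defs, 0 facts)

HONEST FRAMING. Nothing about BSD is proved here; no summit statement is proved by this seat; no stub of the skeleton is closed.
This is the one glue on stub D's critical path that LEAD g9 (STATUS 18:58Z «hεav via (a) + FM») and w3 g4 (18:59Z «once your FM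
gives `hprime`») left unassigned. INPUT: a quadratic Galois number field `K/ℚ`; the quadratic Galois character
`ε : Γ_ℚ →* 𝔽_pˣ` of `K` (`ker ε = res(Γ_K)`, values `±1`; w4 g5 `exists_quadraticCharacter` / LEAD g9 `galoisPackage`); Kriz–Li's
Dirichlet character `ε_K` modulo `|d_K|` through `KrizLi2019.IsKroneckerCharacterOf K ε_K` (`ε_K(ℓ) = +1/−1` as `ℓ ∤ d_K` splits / is
inert). OUTPUT: for every `τ ∈ Γ_ℚ`, `Teich(ε τ) = ε_K(χ_{|d_K|} τ)` in `ℚ_p` — verbatim the `hεav` hypothesis of w3 g4's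
`BernoulliUnits.lineDictionary_dirichlet` (p658809), same `haveI : NeZero |d_K|` spelling.

Mechanism (Washington Thm. 14.1 + Neukirch I §9 + the decomposition law; no Chebotarev): Kronecker–Weber for the open-kernel character
`ε` (`Mazur1978.exists_comp_modNCyclotomicCharacter_eq`; the kernel `res(Γ_K)` is open, `isOpen_range_absGaloisRestrict`) gives
`ε = b_ε ∘ χ_n`. For a prime `ℓ ∤ n·|d_K|` pick a prime `𝔓` of `\bar ℤ` above `ℓ` and an arithmetic Frobenius `τ_ℓ ∈ Γ_ℚ` at `𝔓`
(`exists_isArithFrobAt_of_mem_primesAbove_holds`); then `χ_n(τ_ℓ) = ℓ` (`Rat.modNCyclotomicCharacter_of_isArithFrobAt`), so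
`b_ε(ℓ) = ε(τ_ℓ)`, and `ε(τ_ℓ) = 1 ⟺ ℓ` splits in `K` (w6 g0's FROBENIUS MATCHING
`HerbrandQuadraticFrobenius.quadraticCharacter_eq_one_iff_ncard_primesOver_eq_two`, p659097) `⟺ ε_K(ℓ) = 1`
(`IsKroneckerCharacterOf`); with `Teich(±1) = ±1` this is the prime-value agreement `Teich(b_ε(ℓ)) = ε_K(ℓ)`, which w3 g4's part E
`BernoulliUnits.teich_eps_avatar_of_forall_prime` (p658221) upgrades to the pointwise identity.

* `teich_coe_one`, `teich_coe_neg_one` — `Teich(1) = 1`, `Teich(−1) = −1` read in `ℚ_p`;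
* `quadraticCharacter_prime_value` — at a Frobenius `τ_ℓ` (`ℓ ∤ d_K`): `Teich(ε τ_ℓ) = ε_K(ℓ)`;
* `teich_comp_eq_kronecker_at_primes` — the `hprime` binder of part E for `(b_ε, ε_K, N := n·|d_K|)`;
* **`teich_quadraticCharacter_eq_kroneckerCharacter`** — the pointwise avatar `hεav` (finrank-2 form), and
  **`teich_quadraticCharacter_eq_kroneckerCharacter_of_isImaginaryQuadratic`** — the same on Stub H's binder `IsImaginaryQuadratic K`.

beyond-print theorem: NO. References: [Washington1997] Thm. 14.1, §5.1; [NeukirchANT1999] Ch. I §8 (8.2), §9 (9.4)–(9.6);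
[Cox2013] §5 Prop. 5.16; [KrizLi2019] §2 (p. 12, `ε_K`).
-/

set_option autoImplicit false
-- `…BirchSwinnertonDyer.BirchSwinnertonDyer.Theorems…` is the problem's mandated namespace (D-0017).
set_option linter.dupNamespace false

noncomputable section

open scoped Classical
open NumberField Field IsDedekindDomain
open DirichletCharacter Literature.NumberTheory.EllipticCurves.KrizLi2019 Literature.NumberTheory.EllipticCurves
  Literature.NumberTheory.GaloisRepresentations Literature.NumberTheory.NumberFields

namespace Summit.BirchSwinnertonDyer.BirchSwinnertonDyer.Theorems.PrintCFram.HerbrandKroneckerAvatar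

open Summit.BirchSwinnertonDyer.BirchSwinnertonDyer.Theorems.PrintCFram

variable {p : ℕ} [hp : Fact p.Prime]

/-! ## §1 `Teich(±1) = ±1` in `ℚ_p` -/

/-- `Teich(1) = 1`, read in `ℚ_p`. [cite: Washington1997, §5.1] -/
theorem teich_coe_one : (((Kato2004.teichmullerChar p (1 : (ZMod p)ˣ) : ℤ_[p]ˣ) : ℤ_[p]) : ℚ_[p]) = 1 := by
  rw [map_one, Units.val_one, PadicInt.coe_one]

/-- `Teich(−1) = −1`, read in `ℚ_p` (`p` odd). [cite: Washington1997, §5.1] -/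
theorem teich_coe_neg_one (hp2 : p ≠ 2) :
    (((Kato2004.teichmullerChar p (-1 : (ZMod p)ˣ) : ℤ_[p]ˣ) : ℤ_[p]) : ℚ_[p]) = -1 := by
  rw [BernoulliUnits.teichmullerChar_neg_one hp2, Units.val_neg, Units.val_one, PadicInt.coe_neg, PadicInt.coe_one]

/-! ## §2 The value of `Teich ∘ ε` at a Frobenius is the Kronecker value -/

variable {K : Type} [Field K] [NumberField K]

/-- **`Teich(ε(τ_ℓ)) = ε_K(ℓ)` at an arithmetic Frobenius `τ_ℓ`** (`K/ℚ` quadratic Galois, `ℓ ∤ d_K`, `𝔓 ∣ ℓ` a prime of `\bar ℤ`):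
w6 g0's Frobenius matching `ε(τ_ℓ) = 1 ⟺ ℓ` splits, the `IsKroneckerCharacterOf` clause `ε_K(ℓ) = +1/−1`, `ε = ±1` and `Teich(±1) = ±1`.
[cite: NeukirchANT1999, Ch. I §9 (9.4)–(9.6)] [cite: KrizLi2019, §2 (p. 12, ε_K)] -/
theorem quadraticCharacter_prime_value [IsGalois ℚ K] (hp2 : p ≠ 2) (h2 : Module.finrank ℚ K = 2)
    (ε : absoluteGaloisGroup ℚ →* (ZMod p)ˣ) (hεK : ∀ g, g ∈ (absGaloisRestrict ℚ K).range ↔ ε g = 1)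
    (hε : ∀ g, ε g = 1 ∨ ε g = -1)
    (εK : DirichletCharacter ℚ_[p] (NumberField.discr K).natAbs) (hεKr : IsKroneckerCharacterOf K εK)
    {ℓ : ℕ} (hℓ : ℓ.Prime) (hℓd : ¬ ((ℓ : ℤ) ∣ NumberField.discr K))
    {v : HeightOneSpectrum (𝓞 ℚ)} (hv : (ℓ : 𝓞 ℚ) ∈ v.asIdeal) {𝔓 : Ideal (absIntegers (𝓞 ℚ) ℚ)}
    (h𝔓 : 𝔓 ∈ v.primesAbove) {τ : absoluteGaloisGroup ℚ} (hτ : IsArithFrobAt (𝓞 ℚ) τ 𝔓) :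
    (((Kato2004.teichmullerChar p (ε τ) : ℤ_[p]ˣ) : ℤ_[p]) : ℚ_[p]) = εK (ℓ : ZMod (NumberField.discr K).natAbs) := by
  have hFM := HerbrandQuadraticFrobenius.quadraticCharacter_eq_one_iff_ncard_primesOver_eq_two h2 ε hεK hℓ hℓd hv h𝔓 hτ
  rw [hεKr.2 ℓ hℓ hℓd]
  rcases hε τ with h1 | h1
  · rw [if_pos (hFM.mp h1), h1, teich_coe_one]
  · haveI : Fact (2 < p) := ⟨lt_of_le_of_ne hp.out.two_le (Ne.symm hp2)⟩
    have hns : ¬ ((Ideal.span {(ℓ : ℤ)}).primesOver (𝓞 K)).ncard = 2 := fun hsplit => by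
      have h11 : ε τ = 1 := hFM.mpr hsplit
      rw [h1] at h11
      exact ZMod.neg_one_ne_one (Units.ext_iff.mp h11)
    rw [if_neg hns, h1, teich_coe_neg_one hp2]

/-! ## §3 The prime-value agreement `Teich(b_ε(ℓ)) = ε_K(ℓ)` for `ℓ ∤ n·|d_K|` (part E's `hprime`) -/

/-- **Part E's binder `hprime`.** If `ε = b_ε ∘ χ_n` (Kronecker–Weber), then for every prime `ℓ ∤ n·|d_K|` (coprime to `n·|d_K|`):
`Teich(b_ε(ℓ)) = ε_K(ℓ)` — evaluate at an arithmetic Frobenius `τ_ℓ` above `ℓ`, where `χ_n(τ_ℓ) = ℓ`.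
[cite: Washington1997, Thm. 14.1 and §5.1] [cite: NeukirchANT1999, Ch. I §9 (9.4)] -/
theorem teich_comp_eq_kronecker_at_primes [IsGalois ℚ K] (hp2 : p ≠ 2) (h2 : Module.finrank ℚ K = 2)
    (ε : absoluteGaloisGroup ℚ →* (ZMod p)ˣ) (hεK : ∀ g, g ∈ (absGaloisRestrict ℚ K).range ↔ ε g = 1)
    (hε : ∀ g, ε g = 1 ∨ ε g = -1)
    (εK : DirichletCharacter ℚ_[p] (NumberField.discr K).natAbs) (hεKr : IsKroneckerCharacterOf K εK)
    {n : ℕ} [NeZero n] (bε : (ZMod n)ˣ →* (ZMod p)ˣ)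
    (he : ∀ τ : absoluteGaloisGroup ℚ, ε τ = bε (modNCyclotomicCharacter ℚ n τ)) :
    haveI : NeZero (NumberField.discr K).natAbs := ⟨Int.natAbs_ne_zero.mpr (NumberField.discr_ne_zero K)⟩
    ∀ ℓ : ℕ, ℓ.Prime → ¬ ℓ ∣ n * (NumberField.discr K).natAbs → ∀ hℓ : ℓ.Coprime (n * (NumberField.discr K).natAbs),
      (((Kato2004.teichmullerChar p
          (bε (ZMod.unitOfCoprime ℓ (hℓ.coprime_dvd_right (dvd_mul_right n (NumberField.discr K).natAbs)))) : ℤ_[p]ˣ) :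
        ℤ_[p]) : ℚ_[p]) = εK (ℓ : ZMod (NumberField.discr K).natAbs) := by
  haveI hdz : NeZero (NumberField.discr K).natAbs := ⟨Int.natAbs_ne_zero.mpr (NumberField.discr_ne_zero K)⟩
  intro ℓ hℓ hℓN hcop
  have hℓn : ¬ ℓ ∣ n := fun h => hℓN (dvd_mul_of_dvd_left h _)
  have hℓd : ¬ ((ℓ : ℤ) ∣ NumberField.discr K) := fun h =>
    hℓN (dvd_mul_of_dvd_right (Int.natCast_dvd.mp ((Int.dvd_natAbs).mpr h)) _)
  -- a Frobenius at `ℓ`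
  obtain ⟨v, hv⟩ := RingOfIntegers.exists_heightOneSpectrum_natCast_mem ℚ hℓ
  obtain ⟨𝔓, h𝔓⟩ := HeightOneSpectrum.primesAbove_nonempty (v := v)
  obtain ⟨τ, hτ⟩ := HeightOneSpectrum.exists_isArithFrobAt_of_mem_primesAbove_holds (K := ℚ) (v := v) h𝔓
  -- `χ_n(τ) = ℓ`, so `b_ε(ℓ) = ε τ`
  have hχ : (modNCyclotomicCharacter ℚ n τ : ZMod n) = ℓ := Rat.modNCyclotomicCharacter_of_isArithFrobAt hℓ hℓn hv h𝔓 hτ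
  have hu : ZMod.unitOfCoprime ℓ (hcop.coprime_dvd_right (dvd_mul_right n (NumberField.discr K).natAbs)) =
      modNCyclotomicCharacter ℚ n τ := Units.ext (by rw [ZMod.coe_unitOfCoprime, hχ])
  rw [hu, ← he τ]
  exact quadraticCharacter_prime_value hp2 h2 ε hεK hε εK hεKr hℓ hℓd hv h𝔓 hτ

/-! ## §4 The pointwise avatar `hεav` -/

/-- **THE KRONECKER AVATAR OF THE QUADRATIC GALOIS CHARACTER (stub D's `hεav`).** `K/ℚ` quadratic Galois; `ε : Γ_ℚ →* 𝔽_pˣ` with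
`ker ε = res(Γ_K)` and values `±1`; `ε_K` with `IsKroneckerCharacterOf K ε_K`. Then for every `τ ∈ Γ_ℚ`:
**`Teich(ε τ) = ε_K(χ_{|d_K|} τ)`** in `ℚ_p`. [cite: Washington1997, Thm. 14.1 and §5.1] [cite: NeukirchANT1999, Ch. I §9 (9.4)–(9.6)]
[cite: KrizLi2019, §2 (p. 12, ε_K)] -/
theorem teich_quadraticCharacter_eq_kroneckerCharacter [IsGalois ℚ K] (hp2 : p ≠ 2) (h2 : Module.finrank ℚ K = 2)
    (ε : absoluteGaloisGroup ℚ →* (ZMod p)ˣ) (hεK : ∀ g, g ∈ (absGaloisRestrict ℚ K).range ↔ ε g = 1)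
    (hε : ∀ g, ε g = 1 ∨ ε g = -1)
    (εK : DirichletCharacter ℚ_[p] (NumberField.discr K).natAbs) (hεKr : IsKroneckerCharacterOf K εK) :
    haveI : NeZero (NumberField.discr K).natAbs := ⟨Int.natAbs_ne_zero.mpr (NumberField.discr_ne_zero K)⟩
    ∀ τ : absoluteGaloisGroup ℚ, (((Kato2004.teichmullerChar p (ε τ) : ℤ_[p]ˣ) : ℤ_[p]) : ℚ_[p]) =
      εK ((modNCyclotomicCharacter ℚ (NumberField.discr K).natAbs τ : (ZMod (NumberField.discr K).natAbs)ˣ) :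
        ZMod (NumberField.discr K).natAbs) := by
  haveI hdz : NeZero (NumberField.discr K).natAbs := ⟨Int.natAbs_ne_zero.mpr (NumberField.discr_ne_zero K)⟩
  intro τ
  -- Kronecker–Weber for `ε`: its kernel `res(Γ_K)` is open
  have hker : IsOpen ((ε.ker : Subgroup (absoluteGaloisGroup ℚ)) : Set (absoluteGaloisGroup ℚ)) := by
    have hset : ((ε.ker : Subgroup (absoluteGaloisGroup ℚ)) : Set (absoluteGaloisGroup ℚ)) =
        Set.range (absGaloisRestrict ℚ K) := by
      ext g
      rw [SetLike.mem_coe, MonoidHom.mem_ker, ← hεK g, MonoidHom.mem_range, Set.mem_range]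
      rfl
    rw [hset]
    exact isOpen_range_absGaloisRestrict ℚ K
  obtain ⟨n, _, bε, hbε⟩ := Mazur1978.exists_comp_modNCyclotomicCharacter_eq ε hker
  have he : ∀ σ : absoluteGaloisGroup ℚ, ε σ = bε (modNCyclotomicCharacter ℚ n σ) := fun σ => (hbε σ).symm
  have hN : n * (NumberField.discr K).natAbs ≠ 0 := Nat.mul_ne_zero (NeZero.ne n) (NeZero.ne _)
  exact BernoulliUnits.teich_eps_avatar_of_forall_prime ε bε he εK hN
    (teich_comp_eq_kronecker_at_primes hp2 h2 ε hεK hε εK hεKr bε he) τ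

/-- **The same on Stub H's binder `IsImaginaryQuadratic K`** (`[K:ℚ] = 2`, hence `K/ℚ` Galois). For LEAD g9's assembly of
`stub_lineDictionary`: feed `ε`, `hεK`, `hε` from `galoisPackage` and `hεK : IsKroneckerCharacterOf K εK` from the Kriz–Li datum; the
conclusion is the `hεav` argument of `BernoulliUnits.lineDictionary_dirichlet`. [cite: Washington1997, Thm. 14.1 and §5.1]
[cite: KrizLi2019, §2 (p. 12, ε_K)] -/
theorem teich_quadraticCharacter_eq_kroneckerCharacter_of_isImaginaryQuadratic (hp2 : p ≠ 2) (hK : IsImaginaryQuadratic K)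
    (ε : absoluteGaloisGroup ℚ →* (ZMod p)ˣ) (hεK : ∀ g, g ∈ (absGaloisRestrict ℚ K).range ↔ ε g = 1)
    (hε : ∀ g, ε g = 1 ∨ ε g = -1)
    (εK : DirichletCharacter ℚ_[p] (NumberField.discr K).natAbs) (hεKr : IsKroneckerCharacterOf K εK) :
    haveI : NeZero (NumberField.discr K).natAbs := ⟨Int.natAbs_ne_zero.mpr (NumberField.discr_ne_zero K)⟩
    ∀ τ : absoluteGaloisGroup ℚ, (((Kato2004.teichmullerChar p (ε τ) : ℤ_[p]ˣ) : ℤ_[p]) : ℚ_[p]) =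
      εK ((modNCyclotomicCharacter ℚ (NumberField.discr K).natAbs τ : (ZMod (NumberField.discr K).natAbs)ˣ) :
        ZMod (NumberField.discr K).natAbs) := by
  haveI : Algebra.IsQuadraticExtension ℚ K := { finrank_eq_two' := hK.1 }
  haveI : IsGalois ℚ K := inferInstance
  exact teich_quadraticCharacter_eq_kroneckerCharacter hp2 hK.1 ε hεK hε εK hεKr

end Summit.BirchSwinnertonDyer.BirchSwinnertonDyer.Theorems.PrintCFram.HerbrandKroneckerAvatar

end
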